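import Summits.Ventures.PercRepro.Night2LocalD2R14SixOneD
import Summits.Ventures.PercRepro.Night2LocalD2R14CaseA

/-!
# PercRepro — the (6,4) shadow row modulo the six-element columns WITHOUT a far preimage (night-2, gen 16)

With `sum_r14W_col_le_of_card_six_of_far` (Night2LocalD2R14SixOneD) the six-element columns with a far preimage are
discharged inside the assembly `shadowHall_six_four_of_six_columns` (Night2LocalD2R14CaseA):

* **`localShadowHall_caseA_of_six_columns_noFar`**: (LI_G) in Case A modulo the columns at `|S| = 6` with `opFarPre = ∅`;
* **`shadowHall_six_four_of_six_columns_noFar`**: THE (6,4) SHADOW ROW FOR EVERY FINITE MATROID modulo the six-element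
  columns of R1₄ without a far preimage (proofs/NIGHT-2-k1.md §7.1–7.4: proved on paper for every `κ`).
-/

namespace PercRepro.Shadow

open Finset PerFlat ThmH

variable {α : Type*} [DecidableEq α] {M : Matroid α} [M.Finite]

open scoped Classical in
/-- **(LI_G) in Case A of the coloop cell, modulo the six-element columns without a far preimage.** -/
theorem localShadowHall_caseA_of_six_columns_noFar {G : Finset α} (hG : G ∈ flatsQ M (4 + 1))
    (hd : (gr M \ G).card = 2) (hsimple : ∀ e ∈ gr M, ∀ f ∈ gr M, e ≠ f → rkN M {e, f} = 2)
    (hk : kColoops M G = 1) {y : α} (hyG : y ∈ G) (hyc : y ∉ clF M (G.erase y))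
    (hcol6 : ∀ S ∈ shadowAt M (4 + 2) 4 (Uq M (4 + 2) 4) G, S.card = 6 → opFarPre M G S = ∅ →
      ∑ B ∈ membersIn M (Uq M (4 + 2) 4) G, r14W M G B S ≤ 1) :
    LocalShadowHall M 4 G := by
  have hP := four_le_rkN_erase_erase_of_kColoops_eq_one hG hk hyG hyc
  apply localShadowHall_caseA_of_six_columns hG hd hsimple hk hyG hyc
  intro S hS h6
  by_cases hf : opFarPre M G S = ∅
  · exact hcol6 S hS h6 hf
  · exact sum_r14W_col_le_of_card_six_of_far hG hd hsimple hyG hyc hP hS h6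
      (Finset.card_pos.2 (Finset.nonempty_iff_ne_empty.2 hf))

section SixFour

variable {α' : Type} [DecidableEq α']

/-- **THE `(6, 4)` SHADOW ROW FOR EVERY FINITE MATROID, MODULO THE SIX-ELEMENT COLUMNS OF R1₄ WITHOUT A FAR
PREIMAGE** in Case A of the coloop cell of loopless simple rank-`6` matroids. -/
theorem shadowHall_six_four_of_six_columns_noFar
    (hsix : ∀ (N : Matroid α') [N.Finite], (∀ e ∈ gr N, ∀ f ∈ gr N, e ≠ f → rkN N {e, f} = 2) →
      (∀ e ∈ gr N, N.Indep {e}) → N.eRank = ((6 : ℕ) : ℕ∞) →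
      ∀ G ∈ flatsQ N (4 + 1), (gr N \ G).card = 2 → kColoops N G = 1 →
      ∀ y ∈ G, y ∉ clF N (G.erase y) → 6 ≤ rkN N ((gr N).erase y) →
      ∀ S ∈ shadowAt N (4 + 2) 4 (Uq N (4 + 2) 4) G, S.card = 6 → opFarPre N G S = ∅ →
        ∑ B ∈ membersIn N (Uq N (4 + 2) 4) G, r14W N G B S ≤ 1)
    (M : Matroid α') [M.Finite] : ShadowHall M 6 4 (phiK 6 4) := by
  apply shadowHall_six_four_of_local_caseA
  intro N _ hs hl hr G hG hd hk y hyG hyc hr6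
  exact localShadowHall_caseA_of_six_columns_noFar hG hd hs hk hyG hyc (hsix N hs hl hr G hG hd hk y hyG hyc hr6)

end SixFour

end PercRepro.Shadow
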